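import Summits.QuantumFields.YangMills.Theorems.BalabanLadderNTCornerPriceThreePoint
import Summits.QuantumFields.YangMills.Theorems.ConvexGribovBodyBrascampLiebVacuumSCDimensionGapSU2
import Literature.MathematicalPhysics.QuantumLattice.RepLieAlgebraUnitary
import HarnessLib

/-!
# Crux `NT` (stmt-QuantumFields-19353), stub `stub_refpkgT : RefPkgT`: THE CORNER PRICE, III — the numbers at the
# fundamental representation of `SU(2)`: `C₁ ≥ 24`, corner floors `1152‖v‖₁²/κ⁸` and `27648‖f‖₁‖g‖₁‖h‖₁/κ¹²`

Helper file (`--supports stmt-QuantumFields-19353`) of the fleet lead prover of crux `NT` (unit `ym-spine-19353-p1`, GEN 13);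
sequel of `…NTCornerPrice[ThreePoint]`.  The seam's and the femto engine's representation is the fundamental `rF` of `SU(2)`
(`fundamentalLatticeRep 2`); the centre element `−1 ∈ SU(2)` has `Re tr(−1) = −2`, so `D(−1) = 6(2 − (−2)) = 24`:

* (the element `⟨−1, _⟩`, tree `BrascampLiebVacuumSC.DimensionGapSU2.neg_one_mem`): `fundamentalLatticeRep_two_negOne`, **`twentyfour_le_C₁_of_e1osc_at`** / **`twentyfour_le_C₁_of_e1osc`** — clause 1 at `rF` forces `24 ≤ C₁`;
* more generally `twelve_mul_N_le_C₁_of_e1osc_at` — for any `G`, any lattice representation `r` and any `g₀` with `r.ρ g₀ = −1`: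
  `12·N ≤ C₁`;
* **`q2_ge_1152_of_clause4_at`**, **`absQ3_ge_27648_of_clause5_at`** — the registered clause-4 / clause-5 inequalities at `rF`, one
  coupling, give `ε + 1152·((s/κ)⁴S_θ)((s/κ)⁴S_v) ≤ Q2(θv,v)` and `ε + 27648·(s/κ)¹²·S_fS_gS_h ≤ |Q3(f,g,h)|`.

HONEST FRAMING.  Arithmetic over the sequels; necessary conditions on instances of the registered stub at `rF`; no floor, not AF, not NT,
not the seam, not the gap; not Clay.
-/

set_option autoImplicit false

noncomputable section

open scoped SchwartzMap
open MeasureTheory Filter Topology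
open Literature.MathematicalPhysics.QuantumFieldTheory Literature.MathematicalPhysics.QuantumLattice
open Literature.Probability.LatticeModels
open Summit.QuantumFields.YangMills.Cruxes.OSLegsFromFemtoAndGap.DlrCollarTransfer

namespace Summit.QuantumFields.YangMills.Cruxes.NT.CornerPrice

/-! ## §1 A representation sending some element to `−1` -/

section NegOne

variable (G : Type) [Group G] [TopologicalSpace G] [IsTopologicalGroup G] [CompactSpace G]
  [MeasurableSpace G] [BorelSpace G] (r : LatticeRep G)

omit [IsTopologicalGroup G] [CompactSpace G] [MeasurableSpace G] [BorelSpace G] in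
/-- If `ρ(g₀) = −1` then `6(N − Re tr ρ(g₀)) = 12N`. [folklore] -/
theorem six_mul_sub_trace_of_eq_neg_one {g₀ : G} (h : r.ρ g₀ = -1) : 6 * ((r.N : ℝ) - (r.ρ g₀).trace.re) = 12 * r.N := by
  rw [h, Matrix.trace_neg, Matrix.trace_one]
  simp only [Complex.neg_re, Complex.natCast_re, Fintype.card_fin]
  ring

/-- **`12N ≤ C₁`** from clause 1 at one coupling, whenever some `g₀` is represented by `−1`. [folklore] -/
theorem twelve_mul_N_le_C₁_of_e1osc_at (β : ℝ) {C₁ ℓ s : ℝ} (hsℓ : s ≤ ℓ)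
    (hE1 : ∀ (c : Fin 4 → ℤ) (b : ℕ), (b : ℝ) * s ≤ ℓ → ∀ (η η' : LGConfig 4 G) (x : Fin 4 → ℤ),
      1 ≤ depth c b x → |kerE G r β c b η (dens G r x) - kerE G r β c b η' (dens G r x)| ≤ C₁ / (depth c b x : ℝ) ^ 4)
    {g₀ : G} (h : r.ρ g₀ = -1) : 12 * (r.N : ℝ) ≤ C₁ := by
  have := six_mul_sub_trace_le_of_e1osc_at G r β hsℓ hE1 g₀
  rwa [six_mul_sub_trace_of_eq_neg_one G r h] at this

end NegOne

/-! ## §2 The fundamental representation of `SU(2)` -/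

section SU2

/-- The fundamental representation of `SU(2)` sends the centre element `−1` to `−1`. [folklore] -/
theorem fundamentalLatticeRep_two_negOne :
    (fundamentalLatticeRep 2).ρ ⟨-1, Summit.QuantumFields.YangMills.Theorems.BrascampLiebVacuumSC.DimensionGapSU2.neg_one_mem⟩ = -1 := rfl

/-- **`24 ≤ C₁`** from clause 1 at one coupling, at the fundamental representation of `SU(2)`. [folklore] -/
theorem twentyfour_le_C₁_of_e1osc_at [MeasurableSpace (Matrix.specialUnitaryGroup (Fin 2) ℂ)]
    [BorelSpace (Matrix.specialUnitaryGroup (Fin 2) ℂ)] (β : ℝ) {C₁ ℓ s : ℝ} (hsℓ : s ≤ ℓ)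
    (hE1 : ∀ (c : Fin 4 → ℤ) (b : ℕ), (b : ℝ) * s ≤ ℓ →
      ∀ (η η' : LGConfig 4 (Matrix.specialUnitaryGroup (Fin 2) ℂ)) (x : Fin 4 → ℤ), 1 ≤ depth c b x →
        |kerE (Matrix.specialUnitaryGroup (Fin 2) ℂ) (fundamentalLatticeRep 2) β c b η
            (dens (Matrix.specialUnitaryGroup (Fin 2) ℂ) (fundamentalLatticeRep 2) x) -
          kerE (Matrix.specialUnitaryGroup (Fin 2) ℂ) (fundamentalLatticeRep 2) β c b η'
            (dens (Matrix.specialUnitaryGroup (Fin 2) ℂ) (fundamentalLatticeRep 2) x)| ≤ C₁ / (depth c b x : ℝ) ^ 4) :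
    24 ≤ C₁ := by
  have h := twelve_mul_N_le_C₁_of_e1osc_at (Matrix.specialUnitaryGroup (Fin 2) ℂ) (fundamentalLatticeRep 2) β hsℓ hE1
    fundamentalLatticeRep_two_negOne
  simp only [fundamentalLatticeRep_N, Nat.cast_ofNat] at h
  linarith

/-- **`24 ≤ C₁`** for the registered clause 1 at `rF` (any unit map `a → 0`, range `ℓ > 0`). [folklore] -/
theorem twentyfour_le_C₁_of_e1osc [MeasurableSpace (Matrix.specialUnitaryGroup (Fin 2) ℂ)]
    [BorelSpace (Matrix.specialUnitaryGroup (Fin 2) ℂ)] (a : ℝ → ℝ) (ha0 : Tendsto a atTop (𝓝 0)) {C₁ ℓ : ℝ}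
    (hℓ : 0 < ℓ)
    (hE1 : ∃ β₁ : ℝ, ∀ β : ℝ, β₁ ≤ β → ∀ (c : Fin 4 → ℤ) (b : ℕ), (b : ℝ) * a β ≤ ℓ →
      ∀ (η η' : LGConfig 4 (Matrix.specialUnitaryGroup (Fin 2) ℂ)) (x : Fin 4 → ℤ), 1 ≤ depth c b x →
        |kerE (Matrix.specialUnitaryGroup (Fin 2) ℂ) (fundamentalLatticeRep 2) β c b η
            (dens (Matrix.specialUnitaryGroup (Fin 2) ℂ) (fundamentalLatticeRep 2) x) -
          kerE (Matrix.specialUnitaryGroup (Fin 2) ℂ) (fundamentalLatticeRep 2) β c b η'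
            (dens (Matrix.specialUnitaryGroup (Fin 2) ℂ) (fundamentalLatticeRep 2) x)| ≤ C₁ / (depth c b x : ℝ) ^ 4) :
    24 ≤ C₁ := by
  have h := six_mul_sub_trace_le_of_e1osc (Matrix.specialUnitaryGroup (Fin 2) ℂ) (fundamentalLatticeRep 2) a ha0 hℓ hE1
    ⟨-1, Summit.QuantumFields.YangMills.Theorems.BrascampLiebVacuumSC.DimensionGapSU2.neg_one_mem⟩
  rw [six_mul_sub_trace_of_eq_neg_one _ _ fundamentalLatticeRep_two_negOne] at h
  simp only [fundamentalLatticeRep_N, Nat.cast_ofNat] at h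
  linarith

/-- **`ε + 1152·((s/κ)⁴S_θ)((s/κ)⁴S_v) ≤ Q2(θv,v)`** from the registered clauses 1 and 4 at `rF`, one coupling. [folklore] -/
theorem q2_ge_1152_of_clause4_at [MeasurableSpace (Matrix.specialUnitaryGroup (Fin 2) ℂ)]
    [BorelSpace (Matrix.specialUnitaryGroup (Fin 2) ℂ)] (β : ℝ) {C₁ C₂ ℓ s κ : ℝ} (hC₂ : 0 ≤ C₂) (hsℓ : s ≤ ℓ)
    (hE1 : ∀ (c : Fin 4 → ℤ) (b : ℕ), (b : ℝ) * s ≤ ℓ →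
      ∀ (η η' : LGConfig 4 (Matrix.specialUnitaryGroup (Fin 2) ℂ)) (x : Fin 4 → ℤ), 1 ≤ depth c b x →
        |kerE (Matrix.specialUnitaryGroup (Fin 2) ℂ) (fundamentalLatticeRep 2) β c b η
            (dens (Matrix.specialUnitaryGroup (Fin 2) ℂ) (fundamentalLatticeRep 2) x) -
          kerE (Matrix.specialUnitaryGroup (Fin 2) ℂ) (fundamentalLatticeRep 2) β c b η'
            (dens (Matrix.specialUnitaryGroup (Fin 2) ℂ) (fundamentalLatticeRep 2) x)| ≤ C₁ / (depth c b x : ℝ) ^ 4)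
    {v : 𝓢(EuclideanSpace ℝ (Fin 4), ℝ)} {ε : ℝ} {L : ℕ}
    (hfloor : ε + 2 * (C₁ * (s / κ) ^ 4 * ∑ x ∈ box 4 L, |thetaTest 4 v (s • siteToE x)|) *
          (C₁ * (s / κ) ^ 4 * ∑ y ∈ box 4 L, |v (s • siteToE y)|) +
        C₂ * (s / κ) ^ 4 * ∑ x ∈ box 4 L, ∑ y ∈ box 4 L,
          |thetaTest 4 v (s • siteToE x)| * |v (s • siteToE y)| / (1 + ‖siteToE (y - x)‖) ^ 4 ≤
      Q2 (Matrix.specialUnitaryGroup (Fin 2) ℂ) (fundamentalLatticeRep 2) β L s (thetaTest 4 v) v) :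
    ε + 1152 * (((s / κ) ^ 4 * ∑ x ∈ box 4 L, |thetaTest 4 v (s • siteToE x)|) *
        ((s / κ) ^ 4 * ∑ y ∈ box 4 L, |v (s • siteToE y)|)) ≤
      Q2 (Matrix.specialUnitaryGroup (Fin 2) ℂ) (fundamentalLatticeRep 2) β L s (thetaTest 4 v) v := by
  have h := q2_ge_cornerMargin_of_clause4_at (Matrix.specialUnitaryGroup (Fin 2) ℂ) (fundamentalLatticeRep 2) β hC₂ hsℓ hE1
    hfloor ⟨-1, Summit.QuantumFields.YangMills.Theorems.BrascampLiebVacuumSC.DimensionGapSU2.neg_one_mem⟩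
  rw [six_mul_sub_trace_of_eq_neg_one _ _ fundamentalLatticeRep_two_negOne] at h
  simp only [fundamentalLatticeRep_N, Nat.cast_ofNat] at h
  have e : 2 * (12 * (2 : ℝ) * (s / κ) ^ 4 * ∑ x ∈ box 4 L, |thetaTest 4 v (s • siteToE x)|) *
      (12 * (2 : ℝ) * (s / κ) ^ 4 * ∑ y ∈ box 4 L, |v (s • siteToE y)|) =
      1152 * (((s / κ) ^ 4 * ∑ x ∈ box 4 L, |thetaTest 4 v (s • siteToE x)|) *
        ((s / κ) ^ 4 * ∑ y ∈ box 4 L, |v (s • siteToE y)|)) := by ring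
  linarith

/-- **`ε + 27648·(s/κ)¹²·S_fS_gS_h ≤ |Q3(f,g,h)|`** from the registered clauses 1 and 5 at `rF`, one coupling. [folklore] -/
theorem absQ3_ge_27648_of_clause5_at [MeasurableSpace (Matrix.specialUnitaryGroup (Fin 2) ℂ)]
    [BorelSpace (Matrix.specialUnitaryGroup (Fin 2) ℂ)] (β : ℝ) {C₁ C₂ C₃ ℓ s κ : ℝ} (hC₂ : 0 ≤ C₂) (hC₃ : 0 ≤ C₃)
    (hsℓ : s ≤ ℓ)
    (hE1 : ∀ (c : Fin 4 → ℤ) (b : ℕ), (b : ℝ) * s ≤ ℓ →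
      ∀ (η η' : LGConfig 4 (Matrix.specialUnitaryGroup (Fin 2) ℂ)) (x : Fin 4 → ℤ), 1 ≤ depth c b x →
        |kerE (Matrix.specialUnitaryGroup (Fin 2) ℂ) (fundamentalLatticeRep 2) β c b η
            (dens (Matrix.specialUnitaryGroup (Fin 2) ℂ) (fundamentalLatticeRep 2) x) -
          kerE (Matrix.specialUnitaryGroup (Fin 2) ℂ) (fundamentalLatticeRep 2) β c b η'
            (dens (Matrix.specialUnitaryGroup (Fin 2) ℂ) (fundamentalLatticeRep 2) x)| ≤ C₁ / (depth c b x : ℝ) ^ 4)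
    {f g h : 𝓢(EuclideanSpace ℝ (Fin 4), ℝ)} {ε : ℝ} {L : ℕ}
    (hfloor : ε + ∑ x ∈ box 4 L, ∑ y ∈ box 4 L, ∑ z ∈ box 4 L,
        |f (s • siteToE x)| * |g (s • siteToE y)| * |h (s • siteToE z)| *
          (2 * ((C₁ * (s / κ) ^ 4) * (C₂ * (s / κ) ^ 4 / (1 + ‖siteToE (z - y)‖) ^ 4) +
                (C₁ * (s / κ) ^ 4) * (C₂ * (s / κ) ^ 4 / (1 + ‖siteToE (z - x)‖) ^ 4) +
                (C₁ * (s / κ) ^ 4) * (C₂ * (s / κ) ^ 4 / (1 + ‖siteToE (y - x)‖) ^ 4) +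
                (C₁ * (s / κ) ^ 4) * (C₁ * (s / κ) ^ 4) * (C₁ * (s / κ) ^ 4)) +
            C₃ * (s / κ) ^ 4 / (1 + min (min ‖siteToE (y - x)‖ ‖siteToE (z - y)‖) ‖siteToE (z - x)‖) ^ 8) ≤
      |Q3 (Matrix.specialUnitaryGroup (Fin 2) ℂ) (fundamentalLatticeRep 2) β L s f g h|) :
    ε + 27648 * (s / κ) ^ 12 * ((∑ x ∈ box 4 L, |f (s • siteToE x)|) * (∑ y ∈ box 4 L, |g (s • siteToE y)|) *
        (∑ z ∈ box 4 L, |h (s • siteToE z)|)) ≤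
      |Q3 (Matrix.specialUnitaryGroup (Fin 2) ℂ) (fundamentalLatticeRep 2) β L s f g h| := by
  have hq := q3_ge_cornerMargin_of_clause5_at (Matrix.specialUnitaryGroup (Fin 2) ℂ) (fundamentalLatticeRep 2) β hC₂ hC₃ hsℓ
    hE1 hfloor ⟨-1, Summit.QuantumFields.YangMills.Theorems.BrascampLiebVacuumSC.DimensionGapSU2.neg_one_mem⟩
  rw [six_mul_sub_trace_of_eq_neg_one _ _ fundamentalLatticeRep_two_negOne] at hq
  simp only [fundamentalLatticeRep_N, Nat.cast_ofNat] at hq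
  have e : 2 * (12 * (2 : ℝ) * (s / κ) ^ 4) ^ 3 = 27648 * (s / κ) ^ 12 := by ring
  rw [e] at hq
  exact hq

end SU2

end Summit.QuantumFields.YangMills.Cruxes.NT.CornerPrice

end
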